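import Summits.BirchSwinnertonDyer.BirchSwinnertonDyer.Theorems.SignedLowerHalvesSmallImageLowerHalfBothSignsRttJunctionShaSp2Kernel
import Summits.BirchSwinnertonDyer.BirchSwinnertonDyer.Theorems.SignedLowerHalvesSmallImageLowerHalfBothSignsRttJunctionShaSp2Map
import Summits.BirchSwinnertonDyer.BirchSwinnertonDyer.Theorems.SignedLowerHalvesSmallImageLowerHalfBothSignsRttD2J2DeltaExact
import Summits.BirchSwinnertonDyer.BirchSwinnertonDyer.Theorems.SignedLowerHalvesSmallImageLowerHalfBothSignsRttJunctionShaSp2Finite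
import HarnessLib

/-!
# Route `SignedLowerHalves`, crux L `SmallImageLowerHalfBothSigns` (stmt-BirchSwinnertonDyer-23599), line `rtt_w3` v29 — row **S3α** (`stub_junctionSha_ns`), brick **α1**
# (the specialisation `sp²` in DEGREE 2), INJECTIVITY HALF, brick (i-b): KŐNIG ON THE PAIR LAYERS (every degree) and ★★★ `ker sp² ⊆ T₂ • 𝐇²₂`,
# hence `Function.Injective e` for the brick's `e : QuotSMulTop (C (X − C 0)) 𝐇²₂ →ₗ[Λ_𝒪] 𝐇²_cyc`

INPUTS hand `bsd-inputs-honda-p1` g27 under LEAD `cruxlead-stmt-BirchSwinnertonDyer-23599` g13 (DESIGN `Lines/rtt_w3-DESIGN-S3alpha-lead-g13.md`, brick α1 «∃ e :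
QuotSMulTop (C (X − C 0)) D₂'.H →ₗ[Λ_𝒪] I₂.H, Injective e»). Helper `--supports stmt-BirchSwinnertonDyer-23599`. THEOREMS + two `def`s with bodies (the box families of
Kőnig's lemma, degree-general twins of honda g24's `boxFamiliesO`/`boxTruncO`); no named fact, no `sorry`.
* §1 `boxFamiliesI`, `boxTruncI`, …, ★ `exists_proj_mem_of_closedI` — KŐNIG on the finite pair-layer groups `Hⁱ(G_S(K̃_n), X_k)` in EVERY degree `i` (g24's degree-`1` §2 of
  `…RttD2J2DeltaExact` with `1 ↦ i`): transition-closed level sets with finite layers and non-empty diagonal are met by the projections of ONE element ((P4)).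
* §2 ★★★ `exists_C_X_smul_eq_of_res_eq_zero` — **`sp² x = 0 ⇒ x = T₂ • y`** on pinned `D₂` (degree 2) / `I₂` / `sp²`: the level sets
  `A n k = {y | conj_{γ₂} y − y = D₂.proj n k x}` are non-empty (brick (i-a) `exists_layerConjO_sub_eq_proj_of_res_eq_zero` — exactness at `H²(Maps(G ⧸ V′))` + g24's
  wrong-way map, NO `cd_p ≤ 2`), transition-closed (`layerCoresO_layerConjO`, `layerRedO_layerConjO`, (P1)–(P2)) and finite (`hfin`), so §1 + (P4) + (P6) + (P3) give `y`;
  ★★★ `injective_of_apply_mk_eq_res` — ANY additive `e` on `QuotSMulTop (C (X − C 0)) 𝐇²₂` with `e [x] = sp² x` is injective; ★★★ `exists_injective_specialisationLinearMap₂_frame_zero`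
  — the brick modulo `hfin`, and ★★★ `exists_injective_specialisationLinearMap₂_frame_zero_of_finite` — THE BRICK α1: for `supp(p𝔣)` finite,
  `∃ e : QuotSMulTop (C (X − C 0)) D₂.H →ₗ[Λ_𝒪] I₂.H, Function.Injective e ∧ ∀ x, e [x] = sp² x` (map from `…Sp2Map`; `hfin` discharged by brick (i-c) `…Sp2Finite.finite_layerCohO`
  = NSW (8.3.20), the tree theorem `finite_restrictedCohomology_holds`). Other hypotheses are honda g24's J2 ones (`[FiniteDimensional ℚ_[p] (padicCoeffField S)]`, `γ₂ ∈ ker κ₁`, `κ₂ γ₂ ∈ ℤ_pˣ`,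
`N_{p𝔣} ≤ Gal(K̄/K̃_m)`), supplied in the frame as for J2 (`of_isTopGeneratorPair_unitTwist`, cf2 `ramificationSubgroup_suppPF_le_pairLayerSubgroup`).
HONEST FRAMING: S3α, S3β, S4′, E2, crux L, crux M and BSD remain OPEN; BSD is proved for NO curve.

References: [Rubin2000] Prop. B.1.1 (compactness / Kőnig); [NeukirchSchmidtWingberg2008] I §5 (1.5.1), (8.3.20); [PerrinRiou1994Invent] §1.3; [JohnsonLeungKings2011] §4.2 Def. 4.2 (94),
Lemma 4.4, Cor. 5.3; [SerreGaloisCohomology1997] I §2.2–§2.5.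
-/

set_option autoImplicit false
-- the Theorems namespace of this sub repeats the summit name by design (D-0017 nested layout)
set_option linter.dupNamespace false

noncomputable section

open scoped NumberField Pointwise
open Field IsDedekindDomain
open Literature.NumberTheory.GaloisRepresentations
open Literature.NumberTheory.EllipticCurves
open Literature.NumberTheory.ComplexMultiplication.EllipticUnits (IwasawaAlgebraO₂)
open Literature.NumberTheory.ComplexMultiplication.EllipticUnits.JohnsonLeungKings2011
open Summit.BirchSwinnertonDyer.BirchSwinnertonDyer.Theorems.SmallImageRttD2J1
open Summit.BirchSwinnertonDyer.BirchSwinnertonDyer.Theorems.SmallImageRttD2J2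
open Summit.BirchSwinnertonDyer.BirchSwinnertonDyer.Theorems.SmallImageRttD2J2Delta
open Summit.BirchSwinnertonDyer.BirchSwinnertonDyer.Theorems.SmallImageRttD2Twist

namespace Summit.BirchSwinnertonDyer.BirchSwinnertonDyer.Theorems.SmallImageRttJunctionSha

variable {K : Type} [Field K] [NumberField K] {p : ℕ} [Fact p.Prime] (S : Set (PadicAlgCl p))
  (κ₁ κ₂ : ZpExtension K p) (θ : absoluteGaloisGroup K →ₜ* (padicCoeffIntegers S)ˣ) (𝔣 : Ideal (𝓞 K))

/-! ## §1 Kőnig on the finite pair-layer groups, every degree -/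

section Konig

variable {γ₁ γ₂ : absoluteGaloisGroup K} {i : ℕ} (D₁ : IwasawaCohomologyDataO S κ₁ κ₂ γ₁ γ₂ θ 𝔣 i) (A : ∀ n k : ℕ, Set (layerCohO S κ₁ κ₂ θ 𝔣 n k i))

/-- Box families of level `m`: values in `A` on the box, one-step compatible inside the box, zero outside. [cite: NeukirchSchmidtWingberg2008, I §5 (1.5.1)] -/
def boxFamiliesI (m : ℕ) : Set (∀ n k : ℕ, layerCohO S κ₁ κ₂ θ 𝔣 n k i) :=
  {Y | (∀ n k, n ≤ m → k ≤ m → Y n k ∈ A n k) ∧ (∀ n k, n + 1 ≤ m → k ≤ m → layerCoresO S κ₁ κ₂ θ 𝔣 n k i (Y (n + 1) k) = Y n k) ∧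
    (∀ n k, n ≤ m → k + 1 ≤ m → layerRedO S κ₁ κ₂ θ 𝔣 n k i (Y n (k + 1)) = Y n k) ∧ ∀ n k, ¬ (n ≤ m ∧ k ≤ m) → Y n k = 0}

/-- Truncation to a box (zero outside). [cite: NeukirchSchmidtWingberg2008, I §5 (1.5.1)] -/
def boxTruncI (m : ℕ) (Y : ∀ n k : ℕ, layerCohO S κ₁ κ₂ θ 𝔣 n k i) : ∀ n k : ℕ, layerCohO S κ₁ κ₂ θ 𝔣 n k i :=
  fun n k ↦ if n ≤ m ∧ k ≤ m then Y n k else 0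

variable {S κ₁ κ₂ θ 𝔣 A}

omit [NumberField K] in
/-- Values of the truncation inside the box. [folklore] -/
theorem boxTruncI_of_le {m n k : ℕ} (Y : ∀ n k : ℕ, layerCohO S κ₁ κ₂ θ 𝔣 n k i) (hn : n ≤ m) (hk : k ≤ m) : boxTruncI S κ₁ κ₂ θ 𝔣 m Y n k = Y n k :=
  if_pos ⟨hn, hk⟩

/-- Truncation of a box family is a box family. [cite: NeukirchSchmidtWingberg2008, I §5 (1.5.1)] -/
theorem boxTruncI_mem_boxFamiliesI {m m' : ℕ} (h : m ≤ m') {Y : ∀ n k : ℕ, layerCohO S κ₁ κ₂ θ 𝔣 n k i} (hY : Y ∈ boxFamiliesI S κ₁ κ₂ θ 𝔣 A m') :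
    boxTruncI S κ₁ κ₂ θ 𝔣 m Y ∈ boxFamiliesI S κ₁ κ₂ θ 𝔣 A m := by
  refine ⟨fun n k hn hk ↦ ?_, fun n k hn hk ↦ ?_, fun n k hn hk ↦ ?_, fun n k hnk ↦ if_neg hnk⟩
  · rw [boxTruncI_of_le Y hn hk]; exact hY.1 n k (hn.trans h) (hk.trans h)
  · rw [boxTruncI_of_le Y hn hk, boxTruncI_of_le Y (Nat.le_of_succ_le hn) hk]; exact hY.2.1 n k (hn.trans h) (hk.trans h)
  · rw [boxTruncI_of_le Y hn hk, boxTruncI_of_le Y hn (Nat.le_of_succ_le hk)]; exact hY.2.2.1 n k (hn.trans h) (hk.trans h)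

omit [NumberField K] in
/-- Truncations compose. [folklore] -/
theorem boxTruncI_boxTruncI {m m' : ℕ} (h : m ≤ m') (Y : ∀ n k : ℕ, layerCohO S κ₁ κ₂ θ 𝔣 n k i) :
    boxTruncI S κ₁ κ₂ θ 𝔣 m (boxTruncI S κ₁ κ₂ θ 𝔣 m' Y) = boxTruncI S κ₁ κ₂ θ 𝔣 m Y := funext fun n ↦ funext fun k ↦ by
  by_cases hnk : n ≤ m ∧ k ≤ m
  · rw [boxTruncI_of_le _ hnk.1 hnk.2, boxTruncI_of_le _ hnk.1 hnk.2, boxTruncI_of_le _ (hnk.1.trans h) (hnk.2.trans h)]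
  · unfold boxTruncI; rw [if_neg hnk, if_neg hnk]

/-- A box family of level `m` is its own truncation. [folklore] -/
theorem boxTruncI_eq_self {m : ℕ} {Y : ∀ n k : ℕ, layerCohO S κ₁ κ₂ θ 𝔣 n k i} (hY : Y ∈ boxFamiliesI S κ₁ κ₂ θ 𝔣 A m) : boxTruncI S κ₁ κ₂ θ 𝔣 m Y = Y :=
  funext fun n ↦ funext fun k ↦ by
    by_cases hnk : n ≤ m ∧ k ≤ m
    · exact boxTruncI_of_le _ hnk.1 hnk.2
    · unfold boxTruncI; rw [if_neg hnk, hY.2.2.2 n k hnk]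

/-- Box families of a fixed level form a finite set when the layer groups are finite. [cite: SerreGaloisCohomology1997, III §4.1 Prop. 8] -/
theorem finite_boxFamiliesI (hfin : ∀ n k : ℕ, Finite (layerCohO S κ₁ κ₂ θ 𝔣 n k i)) (m : ℕ) : Finite {Y // Y ∈ boxFamiliesI S κ₁ κ₂ θ 𝔣 A m} := by
  haveI := hfin
  refine Finite.of_injective (fun Y : {Y // Y ∈ boxFamiliesI S κ₁ κ₂ θ 𝔣 A m} ↦ fun (a : Fin (m + 1)) (b : Fin (m + 1)) ↦ Y.1 a b) fun Y Y' hYY' ↦ ?_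
  refine Subtype.ext (funext fun n ↦ funext fun k ↦ ?_)
  by_cases hnk : n ≤ m ∧ k ≤ m
  · exact congrFun (congrFun hYY' ⟨n, Nat.lt_succ_of_le hnk.1⟩) ⟨k, Nat.lt_succ_of_le hnk.2⟩
  · rw [Y.2.2.2.2 n k hnk, Y'.2.2.2.2 n k hnk]

omit [NumberField K] in
/-- Transition-closed sets are stable under the iterated maps. [cite: NeukirchSchmidtWingberg2008, I §5 (1.5.1)] -/
theorem mem_of_layerRedLEI (hA₂ : ∀ n k y, y ∈ A n (k + 1) → layerRedO S κ₁ κ₂ θ 𝔣 n k i y ∈ A n k) (n k : ℕ) :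
    ∀ (K' : ℕ) (h : k ≤ K') (y : layerCohO S κ₁ κ₂ θ 𝔣 n K' i), y ∈ A n K' → layerRedLEO S κ₁ κ₂ θ 𝔣 n i h y ∈ A n k := by
  refine Nat.le_induction (fun y hy ↦ by rwa [layerRedLEO_refl]) (fun K' hK' ih y hy ↦ ?_)
  rw [layerRedLEO_succ S κ₁ κ₂ θ 𝔣 n i hK']
  exact ih _ (hA₂ n K' y hy)

/-- Transition-closed sets are stable under the iterated corestrictions. [cite: NeukirchSchmidtWingberg2008, I §5 (1.5.1)] -/
theorem mem_of_layerCoresLEI (hA₁ : ∀ n k y, y ∈ A (n + 1) k → layerCoresO S κ₁ κ₂ θ 𝔣 n k i y ∈ A n k) (n k : ℕ) :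
    ∀ (M : ℕ) (h : n ≤ M) (y : layerCohO S κ₁ κ₂ θ 𝔣 M k i), y ∈ A M k → layerCoresLEO S κ₁ κ₂ θ 𝔣 k i h y ∈ A n k := by
  refine Nat.le_induction (fun y hy ↦ by rwa [layerCoresLEO_refl]) (fun M hM ih y hy ↦ ?_)
  rw [layerCoresLEO_succ S κ₁ κ₂ θ 𝔣 k i hM]
  exact ih _ (hA₁ M k y hy)

/-- A diagonal element `e ∈ A m m` spreads to a box family of level `m`. [cite: NeukirchSchmidtWingberg2008, I §5 (1.5.1)] -/
theorem exists_mem_boxFamiliesI (hA₁ : ∀ n k y, y ∈ A (n + 1) k → layerCoresO S κ₁ κ₂ θ 𝔣 n k i y ∈ A n k)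
    (hA₂ : ∀ n k y, y ∈ A n (k + 1) → layerRedO S κ₁ κ₂ θ 𝔣 n k i y ∈ A n k) (m : ℕ) {e : layerCohO S κ₁ κ₂ θ 𝔣 m m i} (he : e ∈ A m m) :
    ∃ Y, Y ∈ boxFamiliesI S κ₁ κ₂ θ 𝔣 A m := by
  refine ⟨fun n k ↦ if h : n ≤ m ∧ k ≤ m then layerCoresLEO S κ₁ κ₂ θ 𝔣 k i h.1 (layerRedLEO S κ₁ κ₂ θ 𝔣 m i h.2 e) else 0,
    fun n k hn hk ↦ ?_, fun n k hn hk ↦ ?_, fun n k hn hk ↦ ?_, fun n k hnk ↦ dif_neg hnk⟩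
  · dsimp only; rw [dif_pos ⟨hn, hk⟩]
    exact mem_of_layerCoresLEI hA₁ n k m hn _ (mem_of_layerRedLEI hA₂ m k m hk e he)
  · dsimp only; rw [dif_pos ⟨hn, hk⟩, dif_pos ⟨Nat.le_of_succ_le hn, hk⟩, layerCoresO_layerCoresLEO]
  · dsimp only; rw [dif_pos ⟨hn, hk⟩, dif_pos ⟨hn, Nat.le_of_succ_le hk⟩, layerRedO_layerCoresLEO, layerRedO_layerRedLEO]

/-- ★ **KŐNIG on the pair layers**: transition-closed level sets `A n k ⊆ H¹(G_S(K̃_n), X_k)` with finite layers and non-empty diagonal are met by the projections of ONE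
element of `D₁.H` ((P4)). [cite: Rubin2000, Prop. B.1.1] [cite: NeukirchSchmidtWingberg2008, I §5 (1.5.1)] -/
theorem exists_proj_mem_of_closedI (hfin : ∀ n k : ℕ, Finite (layerCohO S κ₁ κ₂ θ 𝔣 n k i))
    (hA₁ : ∀ n k y, y ∈ A (n + 1) k → layerCoresO S κ₁ κ₂ θ 𝔣 n k i y ∈ A n k)
    (hA₂ : ∀ n k y, y ∈ A n (k + 1) → layerRedO S κ₁ κ₂ θ 𝔣 n k i y ∈ A n k) (hne : ∀ m : ℕ, (A m m).Nonempty) :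
    ∃ z : D₁.H, ∀ n k : ℕ, D₁.proj n k z ∈ A n k := by
  haveI : ∀ m : ℕ, Finite {Y // Y ∈ boxFamiliesI S κ₁ κ₂ θ 𝔣 A m} := finite_boxFamiliesI hfin
  haveI : ∀ m : ℕ, Nonempty {Y // Y ∈ boxFamiliesI S κ₁ κ₂ θ 𝔣 A m} := fun m ↦ by
    obtain ⟨e, he⟩ := hne m
    obtain ⟨Y, hY⟩ := exists_mem_boxFamiliesI hA₁ hA₂ m he
    exact ⟨⟨Y, hY⟩⟩
  obtain ⟨s, hs⟩ := exists_seq_forall_proj_of_forall_finite (α := fun m ↦ {Y // Y ∈ boxFamiliesI S κ₁ κ₂ θ 𝔣 A m})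
    (fun {i j} hij Y ↦ ⟨boxTruncI S κ₁ κ₂ θ 𝔣 i Y.1, boxTruncI_mem_boxFamiliesI hij Y.2⟩) (fun i Y ↦ Subtype.ext (boxTruncI_eq_self Y.2))
    (fun i j k hij hjk Y ↦ Subtype.ext (boxTruncI_boxTruncI hij Y.1)) (fun i Y ↦ Set.toFinite _)
  have hval : ∀ {m m' : ℕ} (h : m ≤ m') (n k : ℕ), n ≤ m → k ≤ m → (s m).1 n k = (s m').1 n k := fun {m m'} h n k hn hk ↦ by
    have h1 := congrArg Subtype.val (hs h)
    change boxTruncI S κ₁ κ₂ θ 𝔣 m (s m').1 = (s m).1 at h1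
    rw [← h1, boxTruncI_of_le _ hn hk]
  let y : ∀ n k : ℕ, layerCohO S κ₁ κ₂ θ 𝔣 n k i := fun n k ↦ (s (max n k)).1 n k
  have hcores : ∀ n k, layerCoresO S κ₁ κ₂ θ 𝔣 n k i (y (n + 1) k) = y n k := fun n k ↦ by
    change layerCoresO S κ₁ κ₂ θ 𝔣 n k i ((s (max (n + 1) k)).1 (n + 1) k) = (s (max n k)).1 n k
    rw [hval (max_le_max (Nat.le_succ n) le_rfl) n k (le_max_left n k) (le_max_right n k),
      (s (max (n + 1) k)).2.2.1 n k (le_max_left _ _) (le_max_right _ _)]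
  have hred : ∀ n k, layerRedO S κ₁ κ₂ θ 𝔣 n k i (y n (k + 1)) = y n k := fun n k ↦ by
    change layerRedO S κ₁ κ₂ θ 𝔣 n k i ((s (max n (k + 1))).1 n (k + 1)) = (s (max n k)).1 n k
    rw [hval (max_le_max le_rfl (Nat.le_succ k)) n k (le_max_left n k) (le_max_right n k),
      (s (max n (k + 1))).2.2.2.1 n k (le_max_left _ _) (le_max_right _ _)]
  obtain ⟨z, hz⟩ := D₁.proj_surjective y ⟨hcores, hred⟩
  exact ⟨z, fun n k ↦ by rw [hz]; exact (s (max n k)).2.1 n k (le_max_left n k) (le_max_right n k)⟩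

end Konig

/-! ## §2 `ker sp² ⊆ T₂ • 𝐇²₂` and the injectivity of the brick's `e` -/

section Injective

variable {S κ₁ κ₂ θ 𝔣} [FiniteDimensional ℚ_[p] (padicCoeffField S)] {γ₁ γ₂ : absoluteGaloisGroup K}
  (hγ₁ : γ₂ ∈ κ₁.kerSubgroup) (hγu : IsUnit (κ₂ γ₂).toAdd) (hV : ∀ m : ℕ, ramificationSubgroup K (suppPF p 𝔣) ≤ pairLayerSubgroup κ₁ κ₂ m)
  (hfin : ∀ n k : ℕ, Finite (layerCohO S κ₁ κ₂ θ 𝔣 n k 2))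
  {D₂ : IwasawaCohomologyDataO S κ₁ κ₂ γ₁ γ₂ θ 𝔣 2} {D₁ : CycIwasawaCohomologyDataO S κ₁ γ₁ θ (suppPF p 𝔣) 2}
  {res : D₂.H →+ D₁.H} (hres : ∀ (n k : ℕ) (x : D₂.H), D₁.proj n k (res x) = spLevel S κ₁ κ₂ θ 𝔣 n k 2 (D₂.proj n k x))

include hγ₁ hγu hV hfin hres in
/-- ★★★ **`ker sp² ⊆ T₂ • 𝐇²₂`**: if `sp² x = 0` then `x = (C X) • y` for some `y ∈ 𝐇²₂` — the level sets `{y | conj_{γ₂} y − y = D₂.proj n k x}` are non-empty (brick (i-a)),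
transition-closed and finite; Kőnig (§1), (P4), (P6), (P3). The middle exactness of `𝐇²(Λ_{𝒪,2}) —T₂→ 𝐇²(Λ_{𝒪,2}) —sp²→ 𝐇²(Λ_𝒪)` on the pinned data, with NO `cd_p ≤ 2` input.
[cite: PerrinRiou1994Invent, §1.3] [cite: JohnsonLeungKings2011, §4.2 Lemma 4.4] [cite: Rubin2000, Prop. B.1.1] -/
theorem exists_C_X_smul_eq_of_res_eq_zero (x : D₂.H) (hx : res x = 0) :
    ∃ y : D₂.H, (PowerSeries.C (PowerSeries.X : PowerSeries (padicCoeffIntegers S)) : IwasawaAlgebraO₂ S) • y = x := by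
  let A : ∀ n k : ℕ, Set (layerCohO S κ₁ κ₂ θ 𝔣 n k 2) := fun n k ↦ {y | layerConjO S κ₁ κ₂ θ 𝔣 n k 2 γ₂ y - y = D₂.proj n k x}
  have hA₁ : ∀ n k y, y ∈ A (n + 1) k → layerCoresO S κ₁ κ₂ θ 𝔣 n k 2 y ∈ A n k := fun n k y hy ↦ by
    have hy' : layerConjO S κ₁ κ₂ θ 𝔣 (n + 1) k 2 γ₂ y - y = D₂.proj (n + 1) k x := hy
    change layerConjO S κ₁ κ₂ θ 𝔣 n k 2 γ₂ (layerCoresO S κ₁ κ₂ θ 𝔣 n k 2 y) - layerCoresO S κ₁ κ₂ θ 𝔣 n k 2 y = D₂.proj n k x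
    rw [← layerCoresO_layerConjO, ← map_sub, hy', D₂.proj_cores]
  have hA₂ : ∀ n k y, y ∈ A n (k + 1) → layerRedO S κ₁ κ₂ θ 𝔣 n k 2 y ∈ A n k := fun n k y hy ↦ by
    have hy' : layerConjO S κ₁ κ₂ θ 𝔣 n (k + 1) 2 γ₂ y - y = D₂.proj n (k + 1) x := hy
    change layerConjO S κ₁ κ₂ θ 𝔣 n k 2 γ₂ (layerRedO S κ₁ κ₂ θ 𝔣 n k 2 y) - layerRedO S κ₁ κ₂ θ 𝔣 n k 2 y = D₂.proj n k x
    rw [← layerRedO_layerConjO, ← map_sub, hy', D₂.proj_red]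
  have hne : ∀ m : ℕ, (A m m).Nonempty := fun m ↦
    exists_layerConjO_sub_eq_proj_of_res_eq_zero S κ₁ κ₂ θ 𝔣 hγ₁ hγu hV D₂ D₁ res hres x hx m m
  obtain ⟨z, hz⟩ := exists_proj_mem_of_closedI D₂ hfin hA₁ hA₂ hne
  refine ⟨z, sub_eq_zero.mp (D₂.proj_injective _ fun n k ↦ ?_)⟩
  rw [map_sub, D₂.proj_T₂_smul, sub_eq_zero]
  exact hz n k

include hγ₁ hγu hV hfin hres in
/-- ★★★ **INJECTIVITY of the brick's map**: ANY additive `e` on `QuotSMulTop (C (X − C 0)) 𝐇²₂` with `e [x] = sp² x` is injective (`ker sp² ⊆ T₂ • 𝐇²₂ = (C (X − C 0)) • 𝐇²₂`).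
[cite: PerrinRiou1994Invent, §1.3] [cite: JohnsonLeungKings2011, Cor. 5.3 (arXiv p0015:L1–20)] -/
theorem injective_of_apply_mk_eq_res {B : Type*} [AddCommGroup B] (ι : D₁.H →+ B) (hι : Function.Injective ι)
    (e : QuotSMulTop ((PowerSeries.C (PowerSeries.X - PowerSeries.C (0 : padicCoeffIntegers S)) : IwasawaAlgebraO₂ S)) D₂.H →+ B)
    (he : ∀ x : D₂.H, e (Submodule.Quotient.mk x) = ι (res x)) : Function.Injective e := by
  refine (injective_iff_map_eq_zero e).2 fun q hq ↦ ?_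
  obtain ⟨x, rfl⟩ := Submodule.Quotient.mk_surjective _ q
  have hx : res x = 0 := hι (by rw [map_zero]; exact (he x).symm.trans hq)
  obtain ⟨y, rfl⟩ := exists_C_X_smul_eq_of_res_eq_zero hγ₁ hγu hV hfin hres x hx
  exact (Submodule.Quotient.mk_eq_zero _).2 ((Submodule.mem_smul_pointwise_iff_exists _ _ _).2 ⟨y, Submodule.mem_top, by rw [map_zero, sub_zero]⟩)

include hγ₁ hγu hV hfin hres in
/-- ★★★ **THE S3α BRICK α1 (modulo the level finiteness `hfin`, NSW (8.3.20))**: for ANY `Λ_𝒪`-structure on `QuotSMulTop (C (X − C 0)) 𝐇²₂` pinned by the frame's `hιH`,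
`∃ e : QuotSMulTop (C (X − C 0)) D₂.H →ₗ[Λ_𝒪] I₂.H`, INJECTIVE, with `e [x] = sp² x` (map: `…Sp2Map.exists_specialisationLinearMap₂_frame_zero`; injectivity: above).
[cite: JohnsonLeungKings2011, Cor. 5.3 (arXiv p0015:L1–20)] [cite: PerrinRiou1994Invent, §1.3] [cite: NeukirchSchmidtWingberg2008, (8.3.20)] -/
theorem exists_injective_specialisationLinearMap₂_frame_zero
    [Module (IwasawaAlgebraO S) (QuotSMulTop ((PowerSeries.C (PowerSeries.X - PowerSeries.C (0 : padicCoeffIntegers S)) : IwasawaAlgebraO₂ S)) D₂.H)]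
    (hιH : ∀ (l : IwasawaAlgebraO S) (x : QuotSMulTop ((PowerSeries.C (PowerSeries.X - PowerSeries.C (0 : padicCoeffIntegers S)) : IwasawaAlgebraO₂ S)) D₂.H),
      l • x = (PowerSeries.map (PowerSeries.C : padicCoeffIntegers S →+* PowerSeries (padicCoeffIntegers S)) l : IwasawaAlgebraO₂ S) • x) :
    ∃ e : QuotSMulTop ((PowerSeries.C (PowerSeries.X - PowerSeries.C (0 : padicCoeffIntegers S)) : IwasawaAlgebraO₂ S)) D₂.H →ₗ[IwasawaAlgebraO S] D₁.H,
      Function.Injective e ∧ ∀ x : D₂.H, e (Submodule.Quotient.mk x) = res x := by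
  obtain ⟨e, he⟩ := exists_specialisationLinearMap₂_frame_zero hres hγ₁ hιH
  exact ⟨e, injective_of_apply_mk_eq_res hγ₁ hγu hV hfin hres (AddMonoidHom.id _) (fun _ _ h ↦ h) e.toAddMonoidHom he, he⟩

include hγ₁ hγu hV hres in
/-- ★★★ **THE S3α BRICK α1, UNCONDITIONAL FORM** (the level finiteness discharged by brick (i-c) `finite_layerCohO` = NSW (8.3.20), a theorem of the tree): for `supp(p𝔣)` finite
(`𝔣 ≠ ⊥`) and ANY `Λ_𝒪`-structure on `QuotSMulTop (C (X − C 0)) 𝐇²₂` pinned by the frame's `hιH`, `∃ e : QuotSMulTop (C (X − C 0)) D₂.H →ₗ[Λ_𝒪] I₂.H`, INJECTIVE, with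
`e [x] = sp² x`. [cite: JohnsonLeungKings2011, Cor. 5.3 (arXiv p0015:L1–20)] [cite: PerrinRiou1994Invent, §1.3] [cite: NeukirchSchmidtWingberg2008, (8.3.20)] -/
theorem exists_injective_specialisationLinearMap₂_frame_zero_of_finite (hP : (suppPF p 𝔣).Finite)
    [Module (IwasawaAlgebraO S) (QuotSMulTop ((PowerSeries.C (PowerSeries.X - PowerSeries.C (0 : padicCoeffIntegers S)) : IwasawaAlgebraO₂ S)) D₂.H)]
    (hιH : ∀ (l : IwasawaAlgebraO S) (x : QuotSMulTop ((PowerSeries.C (PowerSeries.X - PowerSeries.C (0 : padicCoeffIntegers S)) : IwasawaAlgebraO₂ S)) D₂.H),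
      l • x = (PowerSeries.map (PowerSeries.C : padicCoeffIntegers S →+* PowerSeries (padicCoeffIntegers S)) l : IwasawaAlgebraO₂ S) • x) :
    ∃ e : QuotSMulTop ((PowerSeries.C (PowerSeries.X - PowerSeries.C (0 : padicCoeffIntegers S)) : IwasawaAlgebraO₂ S)) D₂.H →ₗ[IwasawaAlgebraO S] D₁.H,
      Function.Injective e ∧ ∀ x : D₂.H, e (Submodule.Quotient.mk x) = res x :=
  exists_injective_specialisationLinearMap₂_frame_zero hγ₁ hγu hV (fun n k ↦ finite_layerCohO S θ κ₁ κ₂ 𝔣 hP n k 2) hres hιH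

end Injective

end Summit.BirchSwinnertonDyer.BirchSwinnertonDyer.Theorems.SmallImageRttJunctionSha

end
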